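import Summits.Parity.GeneralizedHardyLittlewood.Theses.ShiftedPrimeFactor

/-!
# Route `ShiftedPrimeFactor` — the `[assembly]` item (stmt-Parity-30955)

decomp-parity node G1.2.H «ShiftedPrimeFactor» (lens-3 g5; critic CLEARED HOME/STATUS.md l.282, CRITIC-LEDGER
row 58; route born rev 0, commit 71c3db321872): the assembly
`BoundedSiegelZeroQuality → FixedUpper → UniformUpperGivenFixed → ShiftedLPF → FactorLift → UniformLowerGivenFixed →
GeneralizedHardyLittlewood` is literally the route's gate-written deciding theorem `closes` (D-0027 §2.1),
curried.  Hand by the cell's prover-class seat; no mathematics beyond the route file.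
-/

namespace Summit.Parity.GeneralizedHardyLittlewood.Theses.ShiftedPrimeFactor

/-- **The `[assembly]` item holds** (stmt-Parity-30955): the six route items imply
`GeneralizedHardyLittlewood`, by the route's deciding theorem `closes`. -/
theorem assembly_proof : Assembly :=
  fun hQ hFU hUU hS hF hUL => closes hQ hFU hUU hS hF hUL

end Summit.Parity.GeneralizedHardyLittlewood.Theses.ShiftedPrimeFactor
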